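import Mathlib.Topology.Instances.Shrink
import Literature.Topology.FourManifolds.HomotopySphereSummands
import Literature.Topology.FourManifolds.HomotopySphereSummandsProofs
import Literature.Topology.FourManifolds.SPC4Wave0Proofs
import Literature.Topology.FourManifolds.GluckTwistMeridian
import Literature.Topology.FourManifolds.ConnectedSumSpheres
import Literature.Topology.FourManifolds.ConnectedSumSphereIdentity
import HarnessLib

/-!
# A summand of a homotopy 4-sphere is a homotopy 4-sphere — the named fact by name, modulo
# the characterisation of homotopy 4-spheres

Topic `Literature/Topology/FourManifolds`, link file between `HomotopySphereSummands.lean` (the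
named fact `nonempty_homotopyEquiv_sphere_four_left_of_isConnectedSum`, Kosinski 1993, VI
Prop. 2.1, "only if", `m = 4`) and `HomotopySphereSummandsProofs.lean` (its body at universe `0`
proved from the tree's characterisation of homotopy 4-spheres): the two files were proposed
independently, so neither names the other; here the proved statement is restated with the fact's
NAME as conclusion, which is the form fact accounting and consumers use.

* `nonempty_homotopyEquiv_sphere_four_left_of_isConnectedSum_holds_of_iff` — the fact at
  universe `0` from `nonempty_homotopyEquiv_sphere_four_iff.{0}` (spc4.S10, Freedman–Quinn 1990
  §10.1; `SPC4Wave0.lean`);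
* `nonempty_homotopyEquiv_sphere_four_left_of_isConnectedSum_holds_of_facts` — the fact at
  universe `0` from Poincaré duality, Whitehead's theorem and the CW type of compact manifolds
  (Hatcher Thm. 3.30, Cor. 4.33, Cor. A.12), the named facts behind spc4.S10
  (`nonempty_homotopyEquiv_sphere_four_iff_of_facts`, `HomotopyS4Criterion.lean`);
* `nonempty_homotopyEquiv_sphere_four_left_of_isConnectedSum_univ_of_zero` — the fact at
  universe `0` implies it at every universe `u` (a Hausdorff second countable space is small,
  `small_of_secondCountableTopology`; transport the three `C^∞` structures to `Shrink.{0} _` along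
  `Shrink.homeomorph` — `Homeomorph.transportChartedSpace`, `Homeomorph.transportDiffeomorph`,
  `GluckTwistMeridian.lean` — and the connected-sum relation along the resulting diffeomorphisms,
  `IsConnectedSum.of_diffeomorph`, `.of_diffeomorph_left`, `.of_diffeomorph_right`);
* `nonempty_homotopyEquiv_sphere_four_left_of_isConnectedSum_holds` — **the DISCHARGE** (D-0014)
  of the named fact at every universe: spc4.S10 is now discharged in the tree
  (`nonempty_homotopyEquiv_sphere_four_iff_holds`, `SPC4Wave0Proofs.lean`: Poincaré duality,
  Hurewicz and the CW type of manifolds, all proved), so `_holds_of_iff` gives universe `0` and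
  `_univ_of_zero` the rest.

Nothing here uses `sorry`.

## References

* A. Kosinski, *Differential Manifolds*, Academic Press (1993), Ch. VI §2, Prop. 2.1 (p. 91).
  [Kosinski1993]
* M. Freedman, F. Quinn, *Topology of 4-manifolds*, PUP (1990), §10.1. [FreedmanQuinnPMS1990]
* A. Hatcher, *Algebraic Topology*, CUP (2002), Thm. 3.30, Cor. 4.33, Cor. A.12. [HatcherAT2002]
-/

noncomputable section

open scoped Manifold ContDiff Topology ContinuousMap

namespace Literature.Topology.FourManifolds

/-- **Kosinski's Prop. VI.2.1 ("only if", `m = 4`) at universe `0`, GIVEN the characterisation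
of homotopy 4-spheres** `nonempty_homotopyEquiv_sphere_four_iff.{0}` (spc4.S10): the named fact
`nonempty_homotopyEquiv_sphere_four_left_of_isConnectedSum.{0}` by name
(`nonempty_homotopyEquiv_sphere_four_left_of_isConnectedSum_of_iff`, whose statement is its body).
[cite: Kosinski1993, Ch. VI §2, Prop. 2.1] [cite: FreedmanQuinnPMS1990, §10.1] -/
theorem nonempty_homotopyEquiv_sphere_four_left_of_isConnectedSum_holds_of_iff
    (hS10 : nonempty_homotopyEquiv_sphere_four_iff.{0}) :
    nonempty_homotopyEquiv_sphere_four_left_of_isConnectedSum.{0} :=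
  nonempty_homotopyEquiv_sphere_four_left_of_isConnectedSum_of_iff hS10

/-- **Kosinski's Prop. VI.2.1 ("only if", `m = 4`) at universe `0` from the textbook named
facts** (Poincaré duality `hPD`, Hatcher Thm. 3.30; Whitehead's theorem `hW`, Cor. 4.33; CW type
of compact manifolds `hCW`, Cor. A.12): the named fact
`nonempty_homotopyEquiv_sphere_four_left_of_isConnectedSum.{0}` by name.
[cite: Kosinski1993, Ch. VI §2, Prop. 2.1] [cite: HatcherAT2002, Thm. 3.30, Cor. 4.33, Cor. A.12] -/
theorem nonempty_homotopyEquiv_sphere_four_left_of_isConnectedSum_holds_of_facts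
    (hPD : ∀ (M : Type) [TopologicalSpace M] [CompactSpace M] [T2Space M]
      [ChartedSpace (EuclideanSpace ℝ (Fin 4)) M]
      (μ : Literature.AlgebraicTopology.SingularHomology.HomologicalOrientation ℤ M 4),
      Literature.AlgebraicTopology.SingularHomology.bijective_poincareDualityMap μ (Nat.add_comm 1 3))
    (hW : Literature.AlgebraicTopology.Homotopy.whitehead_exists_homotopyEquiv.{0})
    (hCW : Literature.AlgebraicTopology.Homotopy.exists_cwComplex_homotopyEquiv_of_compactSpace.{0}) :
    nonempty_homotopyEquiv_sphere_four_left_of_isConnectedSum.{0} :=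
  nonempty_homotopyEquiv_sphere_four_left_of_isConnectedSum_of_facts hPD hW hCW

/-! ### Universe lift and the discharge -/

universe u

/-- **The fact at universe `0` implies it at every universe.**  Closed smooth 4-manifolds
`M N P : Type u` are Hausdorff and second countable, hence small
(`small_of_secondCountableTopology`); transport their `C^∞` structures to the copies
`Shrink.{0} _ : Type` along `Shrink.homeomorph` (`Homeomorph.transportChartedSpace`,
`Homeomorph.isManifold_transportChartedSpace`; the homeomorphisms become diffeomorphisms,
`Homeomorph.transportDiffeomorph`), carry the relation `P = M # N` along these diffeomorphisms
(`IsConnectedSum.of_diffeomorph` for the glued manifold, `.of_diffeomorph_left/right` for the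
pieces) and the homotopy equivalence `P ≃ₕ S⁴` along `Shrink.homeomorph P`, apply the
universe-`0` statement, and pull `Shrink.{0} M ≃ₕ S⁴` back along `Shrink.homeomorph M`.
(Same device as `nonempty_diffeomorph_sphere_three_of_univ_zero`, `SPC4Wave0Proofs.lean`.)
[folklore] -/
theorem nonempty_homotopyEquiv_sphere_four_left_of_isConnectedSum_univ_of_zero
    (h : nonempty_homotopyEquiv_sphere_four_left_of_isConnectedSum.{0}) :
    nonempty_homotopyEquiv_sphere_four_left_of_isConnectedSum.{u} := by
  intro M _ _ _ _ _ _ _ N _ _ _ _ _ _ _ P _ _ _ _ _ hP e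
  -- the three small copies in `Type`
  haveI : Small.{0} M := small_of_secondCountableTopology M
  haveI : Small.{0} N := small_of_secondCountableTopology N
  haveI : Small.{0} P := small_of_secondCountableTopology P
  let φM : M ≃ₜ Shrink.{0} M := Shrink.homeomorph M
  let φN : N ≃ₜ Shrink.{0} N := Shrink.homeomorph N
  let φP : P ≃ₜ Shrink.{0} P := Shrink.homeomorph P
  -- transported smooth structures
  letI : ChartedSpace (EuclideanSpace ℝ (Fin 4)) (Shrink.{0} M) :=
    Homeomorph.transportChartedSpace φM
  haveI : IsManifold (𝓡 4) ∞ (Shrink.{0} M) :=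
    Homeomorph.isManifold_transportChartedSpace (I₀ := 𝓡 4) (n := ∞) φM
  letI : ChartedSpace (EuclideanSpace ℝ (Fin 4)) (Shrink.{0} N) :=
    Homeomorph.transportChartedSpace φN
  haveI : IsManifold (𝓡 4) ∞ (Shrink.{0} N) :=
    Homeomorph.isManifold_transportChartedSpace (I₀ := 𝓡 4) (n := ∞) φN
  letI : ChartedSpace (EuclideanSpace ℝ (Fin 4)) (Shrink.{0} P) :=
    Homeomorph.transportChartedSpace φP
  haveI : IsManifold (𝓡 4) ∞ (Shrink.{0} P) :=
    Homeomorph.isManifold_transportChartedSpace (I₀ := 𝓡 4) (n := ∞) φP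
  -- topological hypotheses of the fact, transported
  haveI : T2Space (Shrink.{0} M) := φM.t2Space
  haveI : SecondCountableTopology (Shrink.{0} M) := φM.symm.secondCountableTopology
  haveI : CompactSpace (Shrink.{0} M) := φM.compactSpace
  haveI : ConnectedSpace (Shrink.{0} M) := φM.surjective.connectedSpace φM.continuous
  haveI : T2Space (Shrink.{0} N) := φN.t2Space
  haveI : SecondCountableTopology (Shrink.{0} N) := φN.symm.secondCountableTopology
  haveI : CompactSpace (Shrink.{0} N) := φN.compactSpace
  haveI : ConnectedSpace (Shrink.{0} N) := φN.surjective.connectedSpace φN.continuous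
  haveI : T2Space (Shrink.{0} P) := φP.t2Space
  haveI : SecondCountableTopology (Shrink.{0} P) := φP.symm.secondCountableTopology
  -- the transporting diffeomorphisms and the transported connected sum
  let ψM := Homeomorph.transportDiffeomorph (I₀ := 𝓡 4) (n := ∞) φM
  let ψN := Homeomorph.transportDiffeomorph (I₀ := 𝓡 4) (n := ∞) φN
  let ψP := Homeomorph.transportDiffeomorph (I₀ := 𝓡 4) (n := ∞) φP
  have hP' : IsConnectedSum (𝓡 4) (𝓡 4) (𝓡 4) (Shrink.{0} M) (Shrink.{0} N) (Shrink.{0} P) :=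
    ((hP.of_diffeomorph ψP).of_diffeomorph_left ψM).of_diffeomorph_right ψN
  obtain ⟨eM⟩ := h (Shrink.{0} M) (Shrink.{0} N) (Shrink.{0} P) hP'
    (φP.symm.toHomotopyEquiv.trans e)
  exact ⟨φM.toHomotopyEquiv.trans eM⟩

/-- **Kosinski's Prop. VI.2.1 ("only if", `m = 4`), DISCHARGED** (D-0014): a summand of a
homotopy 4-sphere is a homotopy 4-sphere — if the smooth 4-manifold `P` is a connected sum
`M # N` of closed connected smooth 4-manifolds and `P ≃ₕ S⁴`, then `M ≃ₕ S⁴`, at every universe.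
Printed proof (Kosinski 1993, VI §2, p. 91): `π₁(M₁ # M₂) ≃ π₁(M₁) ∗ π₁(M₂)` (Seifert–van Kampen,
`m ≥ 3`) and `Hᵢ(M₁ # M₂) ≅ Hᵢ(M₁) ⊕ Hᵢ(M₂)` for `0 < i < m` (Mayer–Vietoris), so a summand of a
homotopy sphere is a simply connected homology sphere, hence a homotopy sphere
(Hurewicz–Whitehead).  In the tree: `IsConnectedSum.simplyConnectedSpace_left` and
`isZero_singularHomology_two_left_of_isConnectedSum` (`HomotopySphereSummandsProofs.lean`) feed the
characterisation of homotopy 4-spheres `nonempty_homotopyEquiv_sphere_four_iff` (spc4.S10,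
Freedman–Quinn §10.1), which is DISCHARGED (`nonempty_homotopyEquiv_sphere_four_iff_holds`,
`SPC4Wave0Proofs.lean`); that gives universe `0`
(`nonempty_homotopyEquiv_sphere_four_left_of_isConnectedSum_holds_of_iff`), and
`nonempty_homotopyEquiv_sphere_four_left_of_isConnectedSum_univ_of_zero` lifts it to universe `u`.
Users' hypotheses `(h : nonempty_homotopyEquiv_sphere_four_left_of_isConnectedSum)` are fed this
theorem. [cite: Kosinski1993, Ch. VI §2, Prop. 2.1 (p. 91)] [cite: FreedmanQuinnPMS1990, §10.1] -/
theorem nonempty_homotopyEquiv_sphere_four_left_of_isConnectedSum_holds :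
    nonempty_homotopyEquiv_sphere_four_left_of_isConnectedSum.{u} :=
  nonempty_homotopyEquiv_sphere_four_left_of_isConnectedSum_univ_of_zero
    (nonempty_homotopyEquiv_sphere_four_left_of_isConnectedSum_holds_of_iff
      nonempty_homotopyEquiv_sphere_four_iff_holds)

end Literature.Topology.FourManifolds

end
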